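import Mathlib
import Summits.Ventures.PercRepro2.HCov
import Summits.Ventures.PercRepro2.HCovCubic
import Summits.Ventures.PercRepro2.TriDisagreement
import Summits.Ventures.PercRepro2.TriDisagreementPinned
import Summits.Ventures.PercRepro2.TypedSplit
import Summits.Ventures.PercRepro2.OneTypedEdge
import Summits.Ventures.PercRepro2.StarPattern

/-!
# The three in-cone identities of the degree-three star (blind cell PercRepro2, p1 g11;
LEAD-CCW §3⁗⁗″ in typed counts — ASSIGNMENTS v12.24 (a), twinned with the lead's / engine's
exact LP tables)

With `B(∅)` the typed base of `G − y` (the star pinned closed), `B(P₁)` the «hyperedge `P` of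
type `1`» pattern count (the block `P ⊆ {s₁, s₂, s₃}` open in exactly one copy, summed over the
three copies — `Bone`), and `N_(3,1,1)`, `N_(1,1,3)` the typed counts with a star edge of type `3`
(pinned open), the typed bases at a degree-three unmarked vertex `y` whose star edges are typed
`(1,1,1)`, `(2,1,1)` (root type `2`) and `(1,1,2)` (one other edge of type `2`) are NONNEGATIVE
combinations of pattern counts one vertex down:

* **`star_111`**: `N_(1,1,1) = 6 B(∅) + 2 (B(12₁) + B(13₁) + B(23₁)) + B(T₁)`;
* **`star_211`**: `N_(2,1,1) = N_(3,1,1) + B(T₁) + 2 B(12₁) + 2 B(13₁) + B(23₁)`;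
* **`star_112`**: `N_(1,1,2) = N_(1,1,3) + B(T₁) + B(12₁) + 2 B(13₁) + 2 B(23₁)`.

These are the three IN-CONE cells of the lead's degree-three star cone (INBOX 2069 / 2082: the
out-of-cone cells `(2,1,2)`, `(1,2,2)`, `(2,2,2)` admit no such identity): at such a cell the typed
base is nonnegative as soon as the pattern counts of `G − y` and the contracted count are — no
inequality and no constant, which is exactly where the (c-CW) proxies of NEG-100 / NEG-101 were
never needed. Proof: the placement split of `StarPattern.lean`, closing every pendant copy, and
collecting the `27` (resp. `27` and `9`) placements.
-/

namespace Summit.Ventures.PercRepro2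

open CovForm CovForm.OneTyped CovForm.TypedRed

namespace StarPattern

/-! ## The placement split -/

section StarSplit

variable {V : Type*} {E : Type*} [Fintype E] [DecidableEq E] {R : Type*} [Field R]

/-- **The star split**: with the three star edges of type `1`, the typed count is the sum over the
`27` placements of the pattern counts. -/
theorem typedCount_star_split (ends : E → Sym2 V) (o a₁ a₂ a₃ b : V) {s₁ s₂ s₃ : E}
    (h12 : s₁ ≠ s₂) (h13 : s₁ ≠ s₃) (h23 : s₂ ≠ s₃) (F : Finset E) (hs₁ : s₁ ∈ F) (hs₂ : s₂ ∈ F)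
    (hs₃ : s₃ ∈ F) (z : Config E) (τ : E → ℕ) (hτ₁ : τ s₁ = 1) (hτ₂ : τ s₂ = 1) (hτ₃ : τ s₃ = 1) :
    typedCount F z τ (K3 ends o a₁ a₂ a₃ b : Config E → Config E → Config E → R) =
      ∑ p₁ ∈ placements, ∑ p₂ ∈ placements, ∑ p₃ ∈ placements,
        patCount ends o a₁ a₂ a₃ b s₁ s₂ s₃ (((F.erase s₁).erase s₂).erase s₃)
          (Function.update (Function.update (Function.update z s₁ false) s₂ false) s₃ false) τ
          (p₁.1, p₂.1, p₃.1) (p₁.2.1, p₂.2.1, p₃.2.1) (p₁.2.2, p₂.2.2, p₃.2.2) := by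
  have hs₂' : s₂ ∈ F.erase s₁ := Finset.mem_erase.mpr ⟨h12.symm, hs₂⟩
  have hs₃' : s₃ ∈ (F.erase s₁).erase s₂ := Finset.mem_erase.mpr ⟨h23.symm, Finset.mem_erase.mpr ⟨h13.symm, hs₃⟩⟩
  rw [typedCount_split F s₁ hs₁ z τ]
  simp only [hτ₁, sum_bool3_one]
  simp only [typedCount_split (F.erase s₁) s₂ hs₂', hτ₂, sum_bool3_one]
  simp only [typedCount_split ((F.erase s₁).erase s₂) s₃ hs₃', hτ₃, sum_bool3_one]
  simp only [sum_placements]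
  unfold patCount patKernel starSet
  simp only []

end StarSplit

/-! ## The `(1,1,1)` star identity -/

section Identity

variable {V : Type*} {E : Type*} [Fintype E] [DecidableEq E] {R : Type*} [Field R]
  {ends : E → Sym2 V} {o a₁ a₂ a₃ b : V} {s₁ s₂ s₃ : E} {y u₁ u₂ u₃ : V}

/-- The closed-star base `B(∅)`: the typed base of `G − y`. -/
noncomputable def Bempty (ends : E → Sym2 V) (o a₁ a₂ a₃ b : V) (s₁ s₂ s₃ : E) (F₀ : Finset E)
    (z₀ : Config E) (τ : E → ℕ) : R :=
  patCount ends o a₁ a₂ a₃ b s₁ s₂ s₃ F₀ z₀ τ (false, false, false) (false, false, false)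
    (false, false, false)

/-- The type-`1` hyperedge base `B(P₁)` of a star pattern `P`: `P` open in exactly one copy, summed
over the three copies. -/
noncomputable def Bone (ends : E → Sym2 V) (o a₁ a₂ a₃ b : V) (s₁ s₂ s₃ : E) (F₀ : Finset E)
    (z₀ : Config E) (τ : E → ℕ) (P : Bool × Bool × Bool) : R :=
  patCount ends o a₁ a₂ a₃ b s₁ s₂ s₃ F₀ z₀ τ P (false, false, false) (false, false, false) +
    patCount ends o a₁ a₂ a₃ b s₁ s₂ s₃ F₀ z₀ τ (false, false, false) P (false, false, false) +
    patCount ends o a₁ a₂ a₃ b s₁ s₂ s₃ F₀ z₀ τ (false, false, false) (false, false, false) P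

/-- **The `(1,1,1)` star identity** (LEAD-CCW §3⁗⁗″): at an unmarked vertex `y` of degree three
whose three star edges are typed `1`,
`N = 6 · B(∅) + 2 · (B(12₁) + B(13₁) + B(23₁)) + B(T₁)` — every coefficient nonnegative, so the
typed base is a nonnegative combination of pattern counts one vertex down. -/
theorem star_111 (F : Finset E) (z : Config E) (τ : E → ℕ)
    (D : StarData ends o a₁ a₂ a₃ b s₁ s₂ s₃ y u₁ u₂ u₃ (((F.erase s₁).erase s₂).erase s₃)
      (Function.update (Function.update (Function.update z s₁ false) s₂ false) s₃ false))
    (hs₁ : s₁ ∈ F) (hs₂ : s₂ ∈ F) (hs₃ : s₃ ∈ F) (hτ₁ : τ s₁ = 1) (hτ₂ : τ s₂ = 1)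
    (hτ₃ : τ s₃ = 1) :
    typedCount F z τ (K3 ends o a₁ a₂ a₃ b : Config E → Config E → Config E → R) =
      6 * Bempty ends o a₁ a₂ a₃ b s₁ s₂ s₃ (((F.erase s₁).erase s₂).erase s₃)
          (Function.update (Function.update (Function.update z s₁ false) s₂ false) s₃ false) τ +
        2 * (Bone ends o a₁ a₂ a₃ b s₁ s₂ s₃ (((F.erase s₁).erase s₂).erase s₃)
            (Function.update (Function.update (Function.update z s₁ false) s₂ false) s₃ false) τ
            (true, true, false) +
          Bone ends o a₁ a₂ a₃ b s₁ s₂ s₃ (((F.erase s₁).erase s₂).erase s₃)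
            (Function.update (Function.update (Function.update z s₁ false) s₂ false) s₃ false) τ
            (true, false, true) +
          Bone ends o a₁ a₂ a₃ b s₁ s₂ s₃ (((F.erase s₁).erase s₂).erase s₃)
            (Function.update (Function.update (Function.update z s₁ false) s₂ false) s₃ false) τ
            (false, true, true)) +
        Bone ends o a₁ a₂ a₃ b s₁ s₂ s₃ (((F.erase s₁).erase s₂).erase s₃)
          (Function.update (Function.update (Function.update z s₁ false) s₂ false) s₃ false) τ
          (true, true, true) := by
  rw [typedCount_star_split ends o a₁ a₂ a₃ b D.h12 D.h13 D.h23 F hs₁ hs₂ hs₃ z τ hτ₁ hτ₂ hτ₃]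
  simp only [sum_placements]
  simp only [patCount_close_x D τ (Or.inl rfl), patCount_close_x D τ (Or.inr (Or.inl rfl)),
    patCount_close_x D τ (Or.inr (Or.inr rfl)), patCount_close_y D τ _ (Or.inl rfl),
    patCount_close_y D τ _ (Or.inr (Or.inl rfl)), patCount_close_y D τ _ (Or.inr (Or.inr rfl)),
    patCount_close_w D τ _ _ (Or.inl rfl), patCount_close_w D τ _ _ (Or.inr (Or.inl rfl)),
    patCount_close_w D τ _ _ (Or.inr (Or.inr rfl))]
  unfold Bempty Bone
  ring

end Identity

/-! ## The `(2,1,1)` and `(1,1,2)` star identities -/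

section Identity2

variable {V : Type*} {E : Type*} [Fintype E] [DecidableEq E] {R : Type*} [Field R]
  {ends : E → Sym2 V} {o a₁ a₂ a₃ b : V} {s₁ s₂ s₃ : E} {y u₁ u₂ u₃ : V}

/-- The split with `s₁` of type `t₁ ∈ {1, 2, 3}` and `s₂, s₃` of type `1`: the typed count is the
sum over the placements (the type-`3` placement being `(true, true, true)`). -/
theorem typedCount_star_split_t (ends : E → Sym2 V) (o a₁ a₂ a₃ b : V) {s₁ s₂ s₃ : E}
    (h12 : s₁ ≠ s₂) (h13 : s₁ ≠ s₃) (h23 : s₂ ≠ s₃) (F : Finset E) (hs₁ : s₁ ∈ F) (hs₂ : s₂ ∈ F)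
    (hs₃ : s₃ ∈ F) (z : Config E) (τ : E → ℕ) (hτ₂ : τ s₂ = 1) (hτ₃ : τ s₃ = 1) :
    (τ s₁ = 2 → typedCount F z τ (K3 ends o a₁ a₂ a₃ b : Config E → Config E → Config E → R) =
      ∑ p₁ ∈ placements2, ∑ p₂ ∈ placements, ∑ p₃ ∈ placements,
        patCount ends o a₁ a₂ a₃ b s₁ s₂ s₃ (((F.erase s₁).erase s₂).erase s₃)
          (Function.update (Function.update (Function.update z s₁ false) s₂ false) s₃ false) τ
          (p₁.1, p₂.1, p₃.1) (p₁.2.1, p₂.2.1, p₃.2.1) (p₁.2.2, p₂.2.2, p₃.2.2)) ∧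
    (τ s₁ = 3 → typedCount F z τ (K3 ends o a₁ a₂ a₃ b : Config E → Config E → Config E → R) =
      ∑ p₂ ∈ placements, ∑ p₃ ∈ placements,
        patCount ends o a₁ a₂ a₃ b s₁ s₂ s₃ (((F.erase s₁).erase s₂).erase s₃)
          (Function.update (Function.update (Function.update z s₁ false) s₂ false) s₃ false) τ
          (true, p₂.1, p₃.1) (true, p₂.2.1, p₃.2.1) (true, p₂.2.2, p₃.2.2)) := by
  have hs₂' : s₂ ∈ F.erase s₁ := Finset.mem_erase.mpr ⟨h12.symm, hs₂⟩
  have hs₃' : s₃ ∈ (F.erase s₁).erase s₂ :=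
    Finset.mem_erase.mpr ⟨h23.symm, Finset.mem_erase.mpr ⟨h13.symm, hs₃⟩⟩
  constructor
  · intro hτ₁
    rw [typedCount_split F s₁ hs₁ z τ]
    simp only [hτ₁, sum_bool3_two]
    simp only [typedCount_split (F.erase s₁) s₂ hs₂', hτ₂, sum_bool3_one]
    simp only [typedCount_split ((F.erase s₁).erase s₂) s₃ hs₃', hτ₃, sum_bool3_one]
    simp only [sum_placements, sum_placements2]
    unfold patCount patKernel starSet
    simp only []
  · intro hτ₁
    rw [typedCount_split F s₁ hs₁ z τ]
    simp only [hτ₁, sum_bool3_three]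
    simp only [typedCount_split (F.erase s₁) s₂ hs₂', hτ₂, sum_bool3_one]
    simp only [typedCount_split ((F.erase s₁).erase s₂) s₃ hs₃', hτ₃, sum_bool3_one]
    simp only [sum_placements]
    unfold patCount patKernel starSet
    simp only []

/-- **The `(2,1,1)` star identity** (LEAD-CCW §3⁗⁗″, the root edge `s₁` of type `2`):
`N_(2,1,1) = N_(3,1,1) + B(T₁) + 2 B(12₁) + 2 B(13₁) + B(23₁)`. -/
theorem star_211 (F : Finset E) (z : Config E) (τ : E → ℕ)
    (D : StarData ends o a₁ a₂ a₃ b s₁ s₂ s₃ y u₁ u₂ u₃ (((F.erase s₁).erase s₂).erase s₃)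
      (Function.update (Function.update (Function.update z s₁ false) s₂ false) s₃ false))
    (hs₁ : s₁ ∈ F) (hs₂ : s₂ ∈ F) (hs₃ : s₃ ∈ F) (hτ₁ : τ s₁ = 2) (hτ₂ : τ s₂ = 1)
    (hτ₃ : τ s₃ = 1) :
    typedCount F z τ (K3 ends o a₁ a₂ a₃ b : Config E → Config E → Config E → R) =
      typedCount F z (Function.update τ s₁ 3) (K3 ends o a₁ a₂ a₃ b) +
        Bone ends o a₁ a₂ a₃ b s₁ s₂ s₃ (((F.erase s₁).erase s₂).erase s₃)
          (Function.update (Function.update (Function.update z s₁ false) s₂ false) s₃ false) τ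
          (true, true, true) +
        2 * Bone ends o a₁ a₂ a₃ b s₁ s₂ s₃ (((F.erase s₁).erase s₂).erase s₃)
          (Function.update (Function.update (Function.update z s₁ false) s₂ false) s₃ false) τ
          (true, true, false) +
        2 * Bone ends o a₁ a₂ a₃ b s₁ s₂ s₃ (((F.erase s₁).erase s₂).erase s₃)
          (Function.update (Function.update (Function.update z s₁ false) s₂ false) s₃ false) τ
          (true, false, true) +
        Bone ends o a₁ a₂ a₃ b s₁ s₂ s₃ (((F.erase s₁).erase s₂).erase s₃)
          (Function.update (Function.update (Function.update z s₁ false) s₂ false) s₃ false) τ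
          (false, true, true) := by
  have hτ₂' : Function.update τ s₁ 3 s₂ = 1 := by rw [Function.update_of_ne D.h12.symm]; exact hτ₂
  have hτ₃' : Function.update τ s₁ 3 s₃ = 1 := by rw [Function.update_of_ne D.h13.symm]; exact hτ₃
  have hτ₁' : Function.update τ s₁ 3 s₁ = 3 := Function.update_self _ _ _
  rw [(typedCount_star_split_t ends o a₁ a₂ a₃ b D.h12 D.h13 D.h23 F hs₁ hs₂ hs₃ z τ hτ₂ hτ₃).1 hτ₁,
    (typedCount_star_split_t ends o a₁ a₂ a₃ b D.h12 D.h13 D.h23 F hs₁ hs₂ hs₃ z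
      (Function.update τ s₁ 3) hτ₂' hτ₃').2 hτ₁']
  -- the pattern counts do not see `τ` at `s₁` (it is off `F₀`)
  have hτpat : ∀ U₀ U₁ U₂, patCount (R := R) ends o a₁ a₂ a₃ b s₁ s₂ s₃
      (((F.erase s₁).erase s₂).erase s₃)
      (Function.update (Function.update (Function.update z s₁ false) s₂ false) s₃ false)
      (Function.update τ s₁ 3) U₀ U₁ U₂ =
      patCount ends o a₁ a₂ a₃ b s₁ s₂ s₃ (((F.erase s₁).erase s₂).erase s₃)
      (Function.update (Function.update (Function.update z s₁ false) s₂ false) s₃ false) τ U₀ U₁ U₂ := by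
    intro U₀ U₁ U₂
    unfold patCount
    refine typedCount_congr_τ _ _ (fun e he => ?_) _
    rw [Function.update_of_ne]
    intro h
    subst h
    exact D.hF₁ he
  simp only [sum_placements, sum_placements2, hτpat]
  simp only [patCount_close_x D τ (Or.inl rfl), patCount_close_x D τ (Or.inr (Or.inl rfl)),
    patCount_close_x D τ (Or.inr (Or.inr rfl)), patCount_close_y D τ _ (Or.inl rfl),
    patCount_close_y D τ _ (Or.inr (Or.inl rfl)), patCount_close_y D τ _ (Or.inr (Or.inr rfl)),
    patCount_close_w D τ _ _ (Or.inl rfl), patCount_close_w D τ _ _ (Or.inr (Or.inl rfl)),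
    patCount_close_w D τ _ _ (Or.inr (Or.inr rfl))]
  unfold Bone
  ring

end Identity2

section Identity3

variable {V : Type*} {E : Type*} [Fintype E] [DecidableEq E] {R : Type*} [Field R]
  {ends : E → Sym2 V} {o a₁ a₂ a₃ b : V} {s₁ s₂ s₃ : E} {y u₁ u₂ u₃ : V}

/-- The split with `s₃` of type `2` or `3` and `s₁, s₂` of type `1`. -/
theorem typedCount_star_split_t3 (ends : E → Sym2 V) (o a₁ a₂ a₃ b : V) {s₁ s₂ s₃ : E}
    (h12 : s₁ ≠ s₂) (h13 : s₁ ≠ s₃) (h23 : s₂ ≠ s₃) (F : Finset E) (hs₁ : s₁ ∈ F) (hs₂ : s₂ ∈ F)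
    (hs₃ : s₃ ∈ F) (z : Config E) (τ : E → ℕ) (hτ₁ : τ s₁ = 1) (hτ₂ : τ s₂ = 1) :
    (τ s₃ = 2 → typedCount F z τ (K3 ends o a₁ a₂ a₃ b : Config E → Config E → Config E → R) =
      ∑ p₁ ∈ placements, ∑ p₂ ∈ placements, ∑ p₃ ∈ placements2,
        patCount ends o a₁ a₂ a₃ b s₁ s₂ s₃ (((F.erase s₁).erase s₂).erase s₃)
          (Function.update (Function.update (Function.update z s₁ false) s₂ false) s₃ false) τ
          (p₁.1, p₂.1, p₃.1) (p₁.2.1, p₂.2.1, p₃.2.1) (p₁.2.2, p₂.2.2, p₃.2.2)) ∧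
    (τ s₃ = 3 → typedCount F z τ (K3 ends o a₁ a₂ a₃ b : Config E → Config E → Config E → R) =
      ∑ p₁ ∈ placements, ∑ p₂ ∈ placements,
        patCount ends o a₁ a₂ a₃ b s₁ s₂ s₃ (((F.erase s₁).erase s₂).erase s₃)
          (Function.update (Function.update (Function.update z s₁ false) s₂ false) s₃ false) τ
          (p₁.1, p₂.1, true) (p₁.2.1, p₂.2.1, true) (p₁.2.2, p₂.2.2, true)) := by
  have hs₂' : s₂ ∈ F.erase s₁ := Finset.mem_erase.mpr ⟨h12.symm, hs₂⟩
  have hs₃' : s₃ ∈ (F.erase s₁).erase s₂ :=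
    Finset.mem_erase.mpr ⟨h23.symm, Finset.mem_erase.mpr ⟨h13.symm, hs₃⟩⟩
  constructor
  · intro hτ₃
    rw [typedCount_split F s₁ hs₁ z τ]
    simp only [hτ₁, sum_bool3_one]
    simp only [typedCount_split (F.erase s₁) s₂ hs₂', hτ₂, sum_bool3_one]
    simp only [typedCount_split ((F.erase s₁).erase s₂) s₃ hs₃', hτ₃, sum_bool3_two]
    simp only [sum_placements, sum_placements2]
    unfold patCount patKernel starSet
    simp only []
  · intro hτ₃
    rw [typedCount_split F s₁ hs₁ z τ]
    simp only [hτ₁, sum_bool3_one]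
    simp only [typedCount_split (F.erase s₁) s₂ hs₂', hτ₂, sum_bool3_one]
    simp only [typedCount_split ((F.erase s₁).erase s₂) s₃ hs₃', hτ₃, sum_bool3_three]
    simp only [sum_placements]
    unfold patCount patKernel starSet
    simp only []

/-- **The `(1,1,2)` star identity** (LEAD-CCW §3⁗⁗″, the root edge `s₁` of type `1`, one other
star edge of type `2`): `N_(1,1,2) = N_(1,1,3) + B(T₁) + B(12₁) + 2 B(13₁) + 2 B(23₁)`. -/
theorem star_112 (F : Finset E) (z : Config E) (τ : E → ℕ)
    (D : StarData ends o a₁ a₂ a₃ b s₁ s₂ s₃ y u₁ u₂ u₃ (((F.erase s₁).erase s₂).erase s₃)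
      (Function.update (Function.update (Function.update z s₁ false) s₂ false) s₃ false))
    (hs₁ : s₁ ∈ F) (hs₂ : s₂ ∈ F) (hs₃ : s₃ ∈ F) (hτ₁ : τ s₁ = 1) (hτ₂ : τ s₂ = 1)
    (hτ₃ : τ s₃ = 2) :
    typedCount F z τ (K3 ends o a₁ a₂ a₃ b : Config E → Config E → Config E → R) =
      typedCount F z (Function.update τ s₃ 3) (K3 ends o a₁ a₂ a₃ b) +
        Bone ends o a₁ a₂ a₃ b s₁ s₂ s₃ (((F.erase s₁).erase s₂).erase s₃)
          (Function.update (Function.update (Function.update z s₁ false) s₂ false) s₃ false) τ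
          (true, true, true) +
        Bone ends o a₁ a₂ a₃ b s₁ s₂ s₃ (((F.erase s₁).erase s₂).erase s₃)
          (Function.update (Function.update (Function.update z s₁ false) s₂ false) s₃ false) τ
          (true, true, false) +
        2 * Bone ends o a₁ a₂ a₃ b s₁ s₂ s₃ (((F.erase s₁).erase s₂).erase s₃)
          (Function.update (Function.update (Function.update z s₁ false) s₂ false) s₃ false) τ
          (true, false, true) +
        2 * Bone ends o a₁ a₂ a₃ b s₁ s₂ s₃ (((F.erase s₁).erase s₂).erase s₃)
          (Function.update (Function.update (Function.update z s₁ false) s₂ false) s₃ false) τ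
          (false, true, true) := by
  have hτ₁' : Function.update τ s₃ 3 s₁ = 1 := by rw [Function.update_of_ne D.h13]; exact hτ₁
  have hτ₂' : Function.update τ s₃ 3 s₂ = 1 := by rw [Function.update_of_ne D.h23]; exact hτ₂
  have hτ₃' : Function.update τ s₃ 3 s₃ = 3 := Function.update_self _ _ _
  rw [(typedCount_star_split_t3 ends o a₁ a₂ a₃ b D.h12 D.h13 D.h23 F hs₁ hs₂ hs₃ z τ hτ₁ hτ₂).1 hτ₃,
    (typedCount_star_split_t3 ends o a₁ a₂ a₃ b D.h12 D.h13 D.h23 F hs₁ hs₂ hs₃ z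
      (Function.update τ s₃ 3) hτ₁' hτ₂').2 hτ₃']
  have hτpat : ∀ U₀ U₁ U₂, patCount (R := R) ends o a₁ a₂ a₃ b s₁ s₂ s₃
      (((F.erase s₁).erase s₂).erase s₃)
      (Function.update (Function.update (Function.update z s₁ false) s₂ false) s₃ false)
      (Function.update τ s₃ 3) U₀ U₁ U₂ =
      patCount ends o a₁ a₂ a₃ b s₁ s₂ s₃ (((F.erase s₁).erase s₂).erase s₃)
      (Function.update (Function.update (Function.update z s₁ false) s₂ false) s₃ false) τ U₀ U₁ U₂ := by
    intro U₀ U₁ U₂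
    unfold patCount
    refine typedCount_congr_τ _ _ (fun e he => ?_) _
    rw [Function.update_of_ne]
    intro h
    subst h
    exact D.hF₃ he
  simp only [sum_placements, sum_placements2, hτpat]
  simp only [patCount_close_x D τ (Or.inl rfl), patCount_close_x D τ (Or.inr (Or.inl rfl)),
    patCount_close_x D τ (Or.inr (Or.inr rfl)), patCount_close_y D τ _ (Or.inl rfl),
    patCount_close_y D τ _ (Or.inr (Or.inl rfl)), patCount_close_y D τ _ (Or.inr (Or.inr rfl)),
    patCount_close_w D τ _ _ (Or.inl rfl), patCount_close_w D τ _ _ (Or.inr (Or.inl rfl)),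
    patCount_close_w D τ _ _ (Or.inr (Or.inr rfl))]
  unfold Bone
  ring

end Identity3

end StarPattern

end Summit.Ventures.PercRepro2
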